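import Summits.QuantumFields.YangMills.Theorems.SlowBitWindowPersistenceChain
import Summits.QuantumFields.YangMills.Theorems.SwapTwistTraceDefs
import Literature.Analysis.OperatorTheory.KernelIterateBridge
import Literature.Analysis.OperatorTheory.CyclicKernelSpectralBound
import HarnessLib

/-!
# Twisted zero-flux rings with a slice-`0` insertion: peeling, operator positivity, and
# ★ `Z^S_A ≤ Z_A` — the `τ`-glued ring restricted to a swap-invariant slice event weighs at most the periodic one

Support module for `SwapTwistDeficit.TwistRatioVanishesFixedL` (item stmt-QuantumFields-23802, O1 of LINE g11-A of seat ym-idea-4) and for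
the twist-ratio window (companion files `…TwistedRingFarBonds`, `…TwistRatioWindow`).  The swap-twisted trace `TT.twistTrace L β (2L)`
(`Z^S = Tr_phys(S (P K_β)^{2L})`, p662796) is the closed chain of `2L` transfer kernels whose seam is glued through the axis exchange
`S = configPerm (swap 0 1)`.  We study the same chain with a bounded insertion `F(U_0)` at slice `0` and an arbitrary measurable gluing map `τ`:

* §1 `twistChainIns_eq_integral_iterate` — PEELING (Literature `integral_cyclic_het_eq_foldr`): for `n ≥ 1` bonds,
  `∫ (∏_{i<n} K_β(U_i,U_{i+1})) K_β^P(U_n, τ U_0) F(U_0) dU⃗ = ∫ F(x) (κ_P^[n] K_β^P(·, τ x))(x) dx`, `κ_P` the pointwise operator of the physical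
  kernel `K_β^P = physKernel β` (`τ = id`: the slice-`0` weight `insTrace L β F 0`-type ring; `τ = S`: the twisted ring with insertion);
* §2 `iterate_pairing_le_half_add` — OPERATOR POSITIVITY: the pairing `b(x,y) = (κ_P^[2j+1] K_β^P(·,y))(x) = ⟨k_x, A_P^{2j} k_y⟩_{L²}` of two
  kernel sections through an EVEN power of the self-adjoint `L²` operator `A_P` of `K_β^P` satisfies `b(x,y) ≤ (b(x,x) + b(y,y))/2`
  (`= ⟨A_P^j k_x, A_P^j k_y⟩ ≤ ‖A_P^j k_x‖ ‖A_P^j k_y‖`; Literature `inner_kernel_section_pow_kernelOp`, `isSelfAdjoint_kernelOp`);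
* §3 ★ `twistChainIndicator_le_insTrace` — for a measurable slice event `A` invariant under `S` and `L ≥ 1`, `β` arbitrary:
  `∫ 𝟙_A(U_0) (∏ K_β) K_β^P(U_{2L-1}, S U_0) dU⃗ ≤ insTrace L β 𝟙_A 0`, i.e. `Tr(𝟙_A S T^{2L}) ≤ Tr(𝟙_A T^{2L})`: §1 twice, §2 with
  `y = S x`, and the change of variables `x ↦ S x` (measure preserving, `A` invariant) on the diagonal term `b(Sx,Sx)`.

HONEST FRAMING: fixed-lattice transfer-matrix bookkeeping (Cauchy–Schwarz in `L²`) for a support item of a DRAFT line onto a RECORD rung (K2a);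
no semiclassics, nothing about infinite volume, the continuum limit or the Clay gap; the YM mass gap is NOT proved.  No `sorry`, no new axiom,
no new definition.  References: [cite: tHooft1979Flux] (twisted partition functions); [cite: ReedSimonI1980, Thm. VI.23] (bounded self-adjoint
operators, `⟨u, A²ᵐ v⟩ = ⟨Aᵐu, Aᵐv⟩`); [cite: MontvayMunster1994, (3.145)] (thermal traces); [cite: SeilerLNP1982, §3] (transfer kernels).
-/

set_option autoImplicit false

noncomputable section

open MeasureTheory Filter Topology Real Function
open scoped Matrix ComplexConjugate BigOperators InnerProductSpace
open Literature.MathematicalPhysics.QuantumLattice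
open Literature.MathematicalPhysics.QuantumFieldTheory hiding SU2
open Literature.Analysis.OperatorTheory
open Summit.QuantumFields.YangMills.Theorems

namespace Summit.QuantumFields.YangMills.Theorems.FemtoTransferGap.TT

open Summit.QuantumFields.YangMills.Theorems.FemtoTransferGap
open Summit.QuantumFields.YangMills.Theorems.FemtoTransferGap.PhysL2

variable {L : ℕ} [NeZero L]

/-! ## §1 Peeling the `τ`-glued ring with a slice-`0` insertion -/

/-- The integrand of the `τ`-glued ring with insertion as a cyclic product of `m+1` bonds `K_β` and one bond
`(u, y) ↦ K_β^P(u, τ y)·F(y)`. [folklore] -/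
theorem twistChainIns_integrand_eq (β : ℝ) (m : ℕ) (τ : GaugeConfig 3 L SU2 → GaugeConfig 3 L SU2) (F : GaugeConfig 3 L SU2 → ℝ)
    (V : Fin (m + 2) → GaugeConfig 3 L SU2) :
    (∏ i : Fin (m + 1), transferKernel su2Rep β (V i.castSucc) (V i.succ)) *
        physAvg (transferKernel su2Rep β (V (Fin.last (m + 1)))) (τ (V 0)) * F (V 0) =
      ∏ t : Fin (m + 2), (fun s : ℕ => if s = m + 1 then (fun x y => physKernel (L := L) β x (τ y) * F y)
        else transferKernel su2Rep β) t (V t) (V (t + 1)) := by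
  symm
  rw [Fin.prod_univ_castSucc, mul_assoc]
  congr 1
  · refine Finset.prod_congr rfl fun i _ => ?_
    have hi : ((Fin.castSucc i : Fin (m + 2)) : ℕ) ≠ m + 1 := by
      rw [Fin.val_castSucc]; exact ne_of_lt i.isLt
    simp only [hi, if_false, Fin.coeSucc_eq_succ]
  · simp only [Fin.val_last, if_true, Fin.last_add_one, physKernel]

/-- **PEELING the `τ`-glued ring with a slice-`0` insertion.**  For `n ≥ 1` bonds, a measurable gluing map `τ` and a bounded measurable
insertion `F`: `∫ (∏_{i<n} K_β(U_i,U_{i+1})) K_β^P(U_n, τ U_0) F(U_0) dU⃗ = ∫ F(x) (κ_P^[n] K_β^P(·, τ x))(x) dx` — the cycle peeled at slice `0`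
(Literature `integral_cyclic_het_eq_foldr`); on the physical seed `K_β^P(·, τ x)` the `K_β`- and `K_β^P`-iterates coincide.
[cite: MontvayMunster1994, (3.145)] [cite: tHooft1979Flux] -/
theorem twistChainIns_eq_integral_iterate (β : ℝ) {n : ℕ} (hn : 1 ≤ n) {τ : GaugeConfig 3 L SU2 → GaugeConfig 3 L SU2} (hτ : Measurable τ)
    {F : GaugeConfig 3 L SU2 → ℝ} (hFm : Measurable F) {CF : ℝ} (hFb : ∀ U, |F U| ≤ CF) :
    ∫ Us : Fin (n + 1) → GaugeConfig 3 L SU2,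
        (∏ i : Fin n, transferKernel su2Rep β (Us i.castSucc) (Us i.succ)) *
          physAvg (transferKernel su2Rep β (Us (Fin.last n))) (τ (Us 0)) * F (Us 0)
        ∂(Measure.pi fun _ : Fin (n + 1) => configMeasure SU2 L) =
      ∫ x, F x * ((fun f : GaugeConfig 3 L SU2 → ℝ => fun w => ∫ z, physKernel β w z * f z ∂configMeasure SU2 L)^[n]
        (fun z => physKernel β z (τ x))) x ∂configMeasure SU2 L := by
  obtain ⟨m, rfl⟩ : ∃ m, n = m + 1 := ⟨n - 1, by omega⟩
  obtain ⟨M, hM0, hM⟩ := exists_abs_transferKernel_le (L := L) β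
  have hCF0 : 0 ≤ CF := (abs_nonneg _).trans (hFb 1)
  set C : ℝ := M * max 1 CF with hCdef
  set κ : ℕ → GaugeConfig 3 L SU2 → GaugeConfig 3 L SU2 → ℝ := fun s => if s = m + 1 then (fun x y => physKernel (L := L) β x (τ y) * F y)
    else transferKernel su2Rep β with hκdef
  have hKPτ : Measurable (uncurry fun x y : GaugeConfig 3 L SU2 => physKernel (L := L) β x (τ y) * F y) := by
    have h1 : Measurable fun p : GaugeConfig 3 L SU2 × GaugeConfig 3 L SU2 => physKernel (L := L) β p.1 (τ p.2) := by
      have h := (stronglyMeasurable_physKernel (L := L) β).measurable.comp (measurable_fst.prodMk (hτ.comp measurable_snd))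
      simpa only [Function.comp_def, Function.uncurry_apply_pair] using h
    have h2 : Measurable fun p : GaugeConfig 3 L SU2 × GaugeConfig 3 L SU2 => F p.2 := hFm.comp measurable_snd
    exact h1.mul h2
  have hκ : ∀ t, Measurable (Function.uncurry (κ t)) := fun t => by
    by_cases ht : t = m + 1
    · simp only [hκdef, ht, if_true]; exact hKPτ
    · simp only [hκdef, ht, if_false]; exact (stronglyMeasurable_transferKernel (L := L) β).measurable
  have hMC : M ≤ C := by
    rw [hCdef]; exact le_mul_of_one_le_right hM0 (le_max_left _ _)
  have hC : ∀ t x y, ‖κ t x y‖ ≤ C := fun t x y => by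
    rw [Real.norm_eq_abs]
    by_cases ht : t = m + 1
    · simp only [hκdef, ht, if_true]
      rw [abs_mul]
      calc |physKernel β x (τ y)| * |F y| ≤ M * CF := mul_le_mul (abs_physKernel_le hM x _) (hFb y) (abs_nonneg _) hM0
        _ ≤ C := by rw [hCdef]; exact mul_le_mul_of_nonneg_left (le_max_right _ _) hM0
    · simp only [hκdef, ht, if_false]; exact (hM x y).trans hMC
  have h1 : (∫ Us : Fin (m + 1 + 1) → GaugeConfig 3 L SU2,
        (∏ i : Fin (m + 1), transferKernel su2Rep β (Us i.castSucc) (Us i.succ)) *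
          physAvg (transferKernel su2Rep β (Us (Fin.last (m + 1)))) (τ (Us 0)) * F (Us 0)
        ∂(Measure.pi fun _ : Fin (m + 1 + 1) => configMeasure SU2 L)) =
      ∫ V : Fin (m + 2) → GaugeConfig 3 L SU2, ∏ t : Fin (m + 2), κ t (V t) (V (t + 1)) ∂(Measure.pi fun _ => configMeasure SU2 L) := by
    refine integral_congr_ae (ae_of_all _ fun V => ?_)
    exact twistChainIns_integrand_eq β m τ F V
  have h2 := integral_cyclic_congr_fin (L := L) (show m + 2 = 1 + m + 1 by omega) κ (configMeasure SU2 L)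
  have h3 := integral_cyclic_het_eq_foldr (ρ := configMeasure SU2 L) hκ hC m
  rw [h1, h2, h3]
  refine integral_congr_ae (ae_of_all _ fun x => ?_)
  dsimp only
  have hlast : κ (m + 1) = fun x y => physKernel (L := L) β x (τ y) * F y := by simp [hκdef]
  have h4 := foldr_op_eq_iterate_of_eq (ρ := configMeasure SU2 L) κ (transferKernel su2Rep β) (m + 1) 0
    (fun i hi => by simp [hκdef, Nat.ne_of_lt hi]) (fun w => κ (m + 1) w x)
  simp only [Nat.add_zero] at h4
  rw [h4, hlast]
  dsimp only
  rw [iterate_kernelOp_mul_const (transferKernel su2Rep β) (m + 1) (fun w => physKernel β w (τ x)) (F x)]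
  dsimp only
  rw [(iterate_physKernelOp_eq hM (isPhys_physKernel_left hM (τ x)) (m + 1)).1, mul_comm]

/-! ## §2 Operator positivity of the even-power pairing of two kernel sections -/

set_option maxHeartbeats 800000 in
/-- **OPERATOR POSITIVITY.**  Let `b(x,y) = (κ_P^[n] K_β^P(·, y))(x)` with `n = 2j+1` odd.  Then `b(x,y) ≤ (b(x,x) + b(y,y))/2` for all `x, y`:
in `L²(dU)`, `b(x,y) = ⟨k_x, A_P^{2j} k_y⟩ = ⟨A_P^j k_x, A_P^j k_y⟩ ≤ ‖A_P^j k_x‖‖A_P^j k_y‖` for the self-adjoint operator `A_P` of the symmetric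
bounded kernel `K_β^P` and its sections `k_u = K_β^P(u, ·)`, and `‖A_P^j k_u‖² = b(u,u)`. [cite: ReedSimonI1980, Thm. VI.23] -/
theorem iterate_pairing_le_half_add (β : ℝ) {n j : ℕ} (hn : n = 2 * j + 1) (x y : GaugeConfig 3 L SU2) :
    ((fun f : GaugeConfig 3 L SU2 → ℝ => fun w => ∫ z, physKernel β w z * f z ∂configMeasure SU2 L)^[n] (fun z => physKernel β z y)) x ≤
      (((fun f : GaugeConfig 3 L SU2 → ℝ => fun w => ∫ z, physKernel β w z * f z ∂configMeasure SU2 L)^[n] (fun z => physKernel β z x)) x +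
        ((fun f : GaugeConfig 3 L SU2 → ℝ => fun w => ∫ z, physKernel β w z * f z ∂configMeasure SU2 L)^[n] (fun z => physKernel β z y)) y) / 2 := by
  subst hn
  haveI : Fact ((2 : ENNReal) ≠ ⊤) := ⟨ENNReal.ofNat_ne_top⟩
  obtain ⟨M0, -, hM0⟩ := exists_abs_transferKernel_le (L := L) β
  have hKP := stronglyMeasurable_physKernel (L := L) β
  have hCP : ∀ U V : GaugeConfig 3 L SU2, ‖physKernel β U V‖ ≤ M0 := fun U V => by
    rw [Real.norm_eq_abs]; exact abs_physKernel_le hM0 U V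
  have hsymm : ∀ U V : GaugeConfig 3 L SU2, physKernel β U V = physKernel β V U := physKernel_symm β
  obtain ⟨AP, hAP⟩ := exists_kernelOp (μ := configMeasure SU2 L) hKP hCP
  have hsa : IsSelfAdjoint AP := isSelfAdjoint_kernelOp hKP hCP hsymm hAP
  -- the sections as bounded measurable functions
  have hsec : ∀ u : GaugeConfig 3 L SU2, (fun z => physKernel β z u) = physKernel β u := fun u => by
    funext z; exact hsymm z u
  have hmeas : ∀ u : GaugeConfig 3 L SU2, Measurable (physKernel β u) := fun u => (hKP.measurable.of_uncurry_left (x := u))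
  have hbdd : ∀ u z : GaugeConfig 3 L SU2, ‖physKernel β u z‖ ≤ M0 := fun u z => hCP u z
  -- notation
  set κ := (fun f : GaugeConfig 3 L SU2 → ℝ => fun w => ∫ z, physKernel β w z * f z ∂configMeasure SU2 L) with hκ
  set kx : Lp ℝ 2 (configMeasure SU2 L) := (memLp_two_of_bound (μ := configMeasure SU2 L) (hmeas x) (hbdd x)).toLp (physKernel β x) with hkx
  set ky : Lp ℝ 2 (configMeasure SU2 L) := (memLp_two_of_bound (μ := configMeasure SU2 L) (hmeas y) (hbdd y)).toLp (physKernel β y) with hky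
  -- the three pairings as inner products
  have hpair : ∀ u v : GaugeConfig 3 L SU2,
      (κ^[2 * j + 1] (fun z => physKernel β z v)) u =
        ⟪(memLp_two_of_bound (μ := configMeasure SU2 L) (hmeas u) (hbdd u)).toLp (physKernel β u),
          (AP ^ (2 * j)) ((memLp_two_of_bound (μ := configMeasure SU2 L) (hmeas v) (hbdd v)).toLp (physKernel β v))⟫_ℝ := by
    intro u v
    rw [hsec v]
    have h := inner_kernel_section_pow_kernelOp (μ := configMeasure SU2 L) hKP hCP hsymm hAP (hmeas v) (hbdd v) (2 * j) u
    rw [hκ, ← h]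
  -- self-adjointness moves `A_P^j` across
  have hsaj : IsSelfAdjoint (AP ^ j) := hsa.pow j
  have hsymj := (ContinuousLinearMap.isSelfAdjoint_iff_isSymmetric.mp hsaj)
  have hsplit : ∀ u v : Lp ℝ 2 (configMeasure SU2 L), ⟪u, (AP ^ (2 * j)) v⟫_ℝ = ⟪(AP ^ j) u, (AP ^ j) v⟫_ℝ := by
    intro u v
    have e : AP ^ (2 * j) = AP ^ j * AP ^ j := by rw [← pow_add]; congr 1; ring
    rw [e]
    show ⟪u, (AP ^ j) ((AP ^ j) v)⟫_ℝ = _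
    exact (hsymj u ((AP ^ j) v)).symm
  rw [hpair x y, hpair x x, hpair y y, hsplit, hsplit, hsplit, real_inner_self_eq_norm_sq, real_inner_self_eq_norm_sq]
  have hcs := real_inner_le_norm ((AP ^ j) kx) ((AP ^ j) ky)
  nlinarith [hcs, two_mul_le_add_sq ‖(AP ^ j) kx‖ ‖(AP ^ j) ky‖]

/-- The diagonal-type evaluation `x ↦ (κ_P^[n] K_β^P(·, τ x))(x)` is measurable, for a measurable `τ`. [folklore] -/
theorem measurable_iterate_section (β : ℝ) (n : ℕ) {τ : GaugeConfig 3 L SU2 → GaugeConfig 3 L SU2} (hτ : Measurable τ) :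
    Measurable fun x : GaugeConfig 3 L SU2 =>
      ((fun f : GaugeConfig 3 L SU2 → ℝ => fun w => ∫ z, physKernel β w z * f z ∂configMeasure SU2 L)^[n] (fun z => physKernel β z (τ x))) x := by
  have hKP := stronglyMeasurable_physKernel (L := L) β
  have hΨ : StronglyMeasurable (uncurry fun (x z : GaugeConfig 3 L SU2) => physKernel β z (τ x)) := by
    have e : (uncurry fun (x z : GaugeConfig 3 L SU2) => physKernel β z (τ x)) =
        (uncurry fun x y : GaugeConfig 3 L SU2 => physKernel (L := L) β x y) ∘ (fun p => (p.2, τ p.1)) := by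
      funext p; rcases p with ⟨a, b⟩
      simp only [Function.uncurry_apply_pair, Function.comp_apply]
    rw [e]
    exact (hKP.measurable.comp (measurable_snd.prodMk (hτ.comp measurable_fst))).stronglyMeasurable
  have h := (stronglyMeasurable_uncurry_iterate_kernel (μ := configMeasure SU2 L) hKP hΨ n).measurable
  have h2 : Measurable fun x : GaugeConfig 3 L SU2 => (x, x) := measurable_id.prodMk measurable_id
  have h3 := h.comp h2
  simpa only [Function.comp_def, Function.uncurry_apply_pair] using h3

/-- Uniform bound `|(κ_P^[n] K_β^P(·, y))(x)| ≤ M^{n+1}` (`|K_β| ≤ M`, probability measure). [folklore] -/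
theorem abs_iterate_section_le {β M : ℝ} (hM : ∀ U V : GaugeConfig 3 L SU2, |transferKernel su2Rep β U V| ≤ M) (n : ℕ)
    (x y : GaugeConfig 3 L SU2) :
    |((fun f : GaugeConfig 3 L SU2 → ℝ => fun w => ∫ z, physKernel β w z * f z ∂configMeasure SU2 L)^[n] (fun z => physKernel β z y)) x| ≤
      M ^ n * M := by
  have hCP : ∀ U V : GaugeConfig 3 L SU2, ‖physKernel β U V‖ ≤ M := fun U V => by
    rw [Real.norm_eq_abs]; exact abs_physKernel_le hM U V
  have h := norm_iterate_kernel_le (μ := configMeasure SU2 L) hCP (f := fun z => physKernel β z y) (B := M) (fun z => hCP z y) n x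
  rwa [Real.norm_eq_abs] at h

/-! ## §3 ★ The twisted ring restricted to a swap-invariant slice event weighs at most the periodic one -/

set_option maxHeartbeats 800000 in
/-- ★ **`Z^S_A ≤ Z_A`.**  For `L ≥ 1`, any `β`, and a measurable slice event `A` invariant under the axis swap `S = configPerm (swap 0 1)`:
`∫ 𝟙_A(U_0) (∏_{i<2L-1} K_β(U_i,U_{i+1})) K_β^P(U_{2L-1}, S U_0) dU⃗ ≤ insTrace L β 𝟙_A 0` — the swap-twisted zero-flux ring restricted to
`{U_0 ∈ A}` weighs at most the periodic ring restricted to the same event (`Tr(𝟙_A S T^{2L}) ≤ Tr(𝟙_A T^{2L})`).  Proof: both sides peel to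
`∫_A b(x, Sx) dx` and `∫_A b(x,x) dx` (§1) with the positive pairing `b` of §2 (`2L − 1 = 2(L−1) + 1`), `b(x,Sx) ≤ (b(x,x) + b(Sx,Sx))/2`, and
`∫_A b(Sx,Sx) dx = ∫_A b(x,x) dx` (`S` measure preserving, `A` invariant). [cite: tHooft1979Flux] [cite: ReedSimonI1980, Thm. VI.23] -/
theorem twistChainIndicator_le_insTrace (β : ℝ) {A : Set (GaugeConfig 3 L SU2)} (hA : MeasurableSet A)
    (hAS : ∀ U, configPerm (Equiv.swap (0 : Fin 3) 1) U ∈ A ↔ U ∈ A) :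
    ∫ Us : Fin (2 * L - 1 + 1) → GaugeConfig 3 L SU2,
        (∏ i : Fin (2 * L - 1), transferKernel su2Rep β (Us i.castSucc) (Us i.succ)) *
          physAvg (transferKernel su2Rep β (Us (Fin.last (2 * L - 1)))) (configPerm (Equiv.swap (0 : Fin 3) 1) (Us 0)) *
          A.indicator (fun _ => (1 : ℝ)) (Us 0)
        ∂(Measure.pi fun _ : Fin (2 * L - 1 + 1) => configMeasure SU2 L) ≤
      insTrace L β (A.indicator fun _ => (1 : ℝ)) 0 := by
  have hL : 1 ≤ L := NeZero.one_le
  set S := configPerm (G := SU2) (L := L) (Equiv.swap (0 : Fin 3) 1) with hS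
  obtain ⟨M, hM0, hM⟩ := exists_abs_transferKernel_le (L := L) β
  set κ := (fun f : GaugeConfig 3 L SU2 → ℝ => fun w => ∫ z, physKernel β w z * f z ∂configMeasure SU2 L) with hκ
  set b : GaugeConfig 3 L SU2 → GaugeConfig 3 L SU2 → ℝ := fun x y => (κ^[2 * L - 1] (fun z => physKernel β z y)) x with hb
  have hFm : Measurable (A.indicator fun _ => (1 : ℝ)) := measurable_const.indicator hA
  have hFb : ∀ U, |A.indicator (fun _ => (1 : ℝ)) U| ≤ 1 := fun U => by
    by_cases hU : U ∈ A
    · rw [Set.indicator_of_mem hU, abs_one]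
    · rw [Set.indicator_of_notMem hU, abs_zero]; exact zero_le_one
  have hSm : Measurable S := S.measurable
  -- peel both rings
  have hlhs := twistChainIns_eq_integral_iterate (L := L) β (n := 2 * L - 1) (by omega) hSm hFm hFb
  have hrhs := twistChainIns_eq_integral_iterate (L := L) β (n := 2 * L - 1) (by omega) (τ := id) measurable_id hFm hFb
  simp only [id] at hrhs
  rw [hlhs, insTrace_indicator_zero, hrhs]
  -- pointwise positivity
  have hpt : ∀ x, A.indicator (fun _ => (1 : ℝ)) x * b x (S x) ≤
      (1 / 2 : ℝ) * (A.indicator (fun _ => (1 : ℝ)) x * b x x) + (1 / 2 : ℝ) * (A.indicator (fun _ => (1 : ℝ)) (S x) * b (S x) (S x)) := by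
    intro x
    have hind : A.indicator (fun _ => (1 : ℝ)) (S x) = A.indicator (fun _ => (1 : ℝ)) x := by
      by_cases hx : x ∈ A
      · rw [Set.indicator_of_mem hx, Set.indicator_of_mem ((hAS x).2 hx)]
      · rw [Set.indicator_of_notMem hx, Set.indicator_of_notMem (fun h => hx ((hAS x).1 h))]
    rw [hind]
    have hpos : 0 ≤ A.indicator (fun _ => (1 : ℝ)) x := Set.indicator_nonneg (fun _ _ => zero_le_one) _
    have hb2 := iterate_pairing_le_half_add (L := L) β (n := 2 * L - 1) (j := L - 1) (by omega) x (S x)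
    simp only [hb] at hb2 ⊢
    nlinarith [mul_le_mul_of_nonneg_left hb2 hpos]
  -- integrability of the three bounded measurable functions
  have hmeasS := measurable_iterate_section (L := L) β (2 * L - 1) hSm
  have hmeasI := measurable_iterate_section (L := L) β (2 * L - 1) (τ := id) measurable_id
  simp only [id] at hmeasI
  have hbd : ∀ x y : GaugeConfig 3 L SU2, |b x y| ≤ M ^ (2 * L - 1) * M := fun x y => abs_iterate_section_le hM (2 * L - 1) x y
  have hint : ∀ {τ : GaugeConfig 3 L SU2 → GaugeConfig 3 L SU2}, Measurable τ →
      (Measurable fun x => b x (τ x)) →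
      Integrable (fun x => A.indicator (fun _ => (1 : ℝ)) x * b x (τ x)) (configMeasure SU2 L) := by
    intro τ _ hmτ
    refine integrable_of_measurable_abs_le _ (hFm.mul hmτ) (C := M ^ (2 * L - 1) * M) fun x => ?_
    rw [abs_mul]
    calc |A.indicator (fun _ => (1 : ℝ)) x| * |b x (τ x)| ≤ 1 * (M ^ (2 * L - 1) * M) :=
          mul_le_mul (hFb x) (hbd x _) (abs_nonneg _) zero_le_one
      _ = M ^ (2 * L - 1) * M := one_mul _
  have hI1 : Integrable (fun x => A.indicator (fun _ => (1 : ℝ)) x * b x (S x)) (configMeasure SU2 L) := hint hSm hmeasS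
  have hI2 : Integrable (fun x => A.indicator (fun _ => (1 : ℝ)) x * b x x) (configMeasure SU2 L) := hint measurable_id hmeasI
  have hI3 : Integrable (fun x => A.indicator (fun _ => (1 : ℝ)) (S x) * b (S x) (S x)) (configMeasure SU2 L) := by
    have hmp := measurePreserving_configPerm' (L := L) (Equiv.swap (0 : Fin 3) 1)
    exact (hmp.integrable_comp hI2.aestronglyMeasurable).mpr hI2
  -- the change of variables on the diagonal term
  have hcov : ∫ x, A.indicator (fun _ => (1 : ℝ)) (S x) * b (S x) (S x) ∂configMeasure SU2 L =
      ∫ x, A.indicator (fun _ => (1 : ℝ)) x * b x x ∂configMeasure SU2 L :=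
    (measurePreserving_configPerm' (L := L) (Equiv.swap (0 : Fin 3) 1)).integral_comp' (f := S)
      (fun x => A.indicator (fun _ => (1 : ℝ)) x * b x x)
  have h23 : Integrable (fun x => (1 / 2 : ℝ) * (A.indicator (fun _ => (1 : ℝ)) x * b x x) +
      (1 / 2 : ℝ) * (A.indicator (fun _ => (1 : ℝ)) (S x) * b (S x) (S x))) (configMeasure SU2 L) :=
    (hI2.const_mul _).add (hI3.const_mul _)
  have hmono := integral_mono hI1 h23 hpt
  rw [integral_add (hI2.const_mul _) (hI3.const_mul _), integral_const_mul, integral_const_mul, hcov] at hmono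
  have e : ∀ x, A.indicator (fun _ => (1 : ℝ)) x * b x (S x) = A.indicator (fun _ => (1 : ℝ)) x * (κ^[2 * L - 1] (fun z => physKernel β z (S x))) x :=
    fun x => rfl
  calc ∫ x, A.indicator (fun _ => (1 : ℝ)) x * (κ^[2 * L - 1] (fun z => physKernel β z (S x))) x ∂configMeasure SU2 L
      = ∫ x, A.indicator (fun _ => (1 : ℝ)) x * b x (S x) ∂configMeasure SU2 L := rfl
    _ ≤ (1 / 2 : ℝ) * ∫ x, A.indicator (fun _ => (1 : ℝ)) x * b x x ∂configMeasure SU2 L +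
          (1 / 2 : ℝ) * ∫ x, A.indicator (fun _ => (1 : ℝ)) x * b x x ∂configMeasure SU2 L := hmono
    _ = ∫ x, A.indicator (fun _ => (1 : ℝ)) x * b x x ∂configMeasure SU2 L := by ring

end Summit.QuantumFields.YangMills.Theorems.FemtoTransferGap.TT

end
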